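import Literature.Topology.FourManifolds.TrisectionsSectorTwoFunction
import Literature.Topology.FourManifolds.FlowFibreMorseIndex
import HarnessLib

/-!
# The second sector's function in the flow-rule region: critical points and their index

Topic `Literature/Topology/FourManifolds`; step E4c (part ii-b) of a Morse-theoretic
construction of Gay–Kirby's trisection for the fact seat
`provefact-Literature.Topology.FourManifolds.exists_isBalancedGKTrisection` (Gay–Kirby 2016,
Thm. 4 via §4, Lemma 14).  Everything in this file is **proved**; no new definitions beyond
the explicit profile `Γ̂₂`.

In the flow-rule region of the band (`TrisectionsSectorTwoFunction.psiTwoRaw_eventuallyEq_flowRule`)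
the second sector's function is `ψ₂ = Γ̂₂(φ̄, f)` near the point, with

  `Γ̂₂(p, q) = 1 - C (q - a)(h₂(p) - (q - a)) w(p)`,
  `∂₂Γ̂₂ = -C w(p)(h₂(p) - 2(q - a))`, `∂₁Γ̂₂ = -C (q - a)(h₂'(p) w(p) + (h₂(p) - (q - a)) w'(p))`,
  `∂₂₂Γ̂₂ = 2C w(p)` (`gammaTwoHat_partials`, `fderiv_fderiv_gammaTwoHat`).

By the flow rule (`FlowFibreMorseData.isMCriticalPt_comp₂_iff`,
`FlowFibreMorseIndex.nondegenerate_iff_and_morseIndex_comp₂_flow`): inside the sector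
(`0 < s`, `w > 0`, `h₂' w + (h₂ - s) w' < 0`), **`z` is critical for `ψ₂` iff `2s = h₂(φ̄ z)` and
the projection `π z` is critical for `φ`** (`HandleBoxes.isMCriticalPt_psiTwo_flowRule_iff`), and
then **the critical point is nondegenerate of index `index_φ(π z)`**
(`HandleBoxes.morseData_psiTwo_flowRule`) — Gay–Kirby's "`[0, ε] × H₁₂` is `♮ S¹ × B³`" in
Morse form: one critical point over each critical point of the Heegaard function in the
handlebody, of the same index.

## References

* D. Gay, R. Kirby, *Trisecting 4-manifolds*, Geom. Topol. 20 (2016), §4, Lemma 14. [GayKirby2016]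
* J. Milnor, *Morse theory* (1963), §2–§3. [Milnor1963]
* J. Milnor, *Lectures on the h-cobordism theorem* (1965), Thm. 3.4, Thm. 4.1. [MilnorHCobordism1965]
-/

open scoped Manifold ContDiff Topology
open Set Function Filter Metric

noncomputable section

universe u

namespace Literature.Topology.FourManifolds

open Flow

/-- Local notation: `𝔼 n` is the model Euclidean space `EuclideanSpace ℝ (Fin n)`. -/
local notation "𝔼 " n:arg => EuclideanSpace ℝ (Fin n)

/-! ### The profile `Γ̂₂` and its partial derivatives -/

section Profile

variable {h₂ w : ℝ → ℝ} {C a : ℝ}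

/-- **The profile of `ψ₂` in the flow-rule region**: `Γ̂₂(p, q) = 1 - C (q - a)(h₂ p - (q - a)) w p`. [cite: GayKirby2016, §4, Lemma 14] -/
def gammaTwoHat (h₂ w : ℝ → ℝ) (C a : ℝ) (r : ℝ × ℝ) : ℝ :=
  1 - C * ((r.2 - a) * (h₂ r.1 - (r.2 - a)) * w r.1)

/-- Unfolding. [folklore] -/
theorem gammaTwoHat_apply (h₂ w : ℝ → ℝ) (C a : ℝ) (r : ℝ × ℝ) :
    gammaTwoHat h₂ w C a r = 1 - C * ((r.2 - a) * (h₂ r.1 - (r.2 - a)) * w r.1) := rfl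

/-- `Γ̂₂` is smooth for smooth profiles. [folklore] -/
theorem contDiff_gammaTwoHat (hh₂ : ContDiff ℝ ∞ h₂) (hw : ContDiff ℝ ∞ w) (C a : ℝ) :
    ContDiff ℝ ∞ (gammaTwoHat h₂ w C a) := by
  unfold gammaTwoHat
  have h1 : ContDiff ℝ ∞ fun r : ℝ × ℝ => r.2 - a := by fun_prop
  exact contDiff_const.sub (contDiff_const.mul
    ((h1.mul ((hh₂.comp contDiff_fst).sub h1)).mul (hw.comp contDiff_fst)))

/-- **The first partials of `Γ̂₂`.** [folklore] -/
theorem gammaTwoHat_partials (hh₂ : ContDiff ℝ ∞ h₂) (hw : ContDiff ℝ ∞ w) (C a : ℝ) (r : ℝ × ℝ) :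
    fderiv ℝ (gammaTwoHat h₂ w C a) r (0, 1) = -C * (w r.1 * (h₂ r.1 - 2 * (r.2 - a))) ∧
      fderiv ℝ (gammaTwoHat h₂ w C a) r (1, 0) =
        -C * ((r.2 - a) * (deriv h₂ r.1 * w r.1 + (h₂ r.1 - (r.2 - a)) * deriv w r.1)) := by
  have hd : Differentiable ℝ (gammaTwoHat h₂ w C a) := (contDiff_gammaTwoHat hh₂ hw C a).differentiable (by simp)
  have hh₂d := hh₂.differentiable (by simp)
  have hwd := hw.differentiable (by simp)
  constructor
  · rw [fderiv_apply_eq_deriv_line (hd r)]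
    have hfun : (fun t : ℝ => gammaTwoHat h₂ w C a (r + t • ((0 : ℝ), (1 : ℝ)))) =
        fun t => 1 - C * (((r.2 - a) + t) * (h₂ r.1 - ((r.2 - a) + t)) * w r.1) := by
      funext t
      simp only [gammaTwoHat, Prod.smul_mk, smul_eq_mul, mul_zero, mul_one, Prod.fst_add, Prod.snd_add, add_zero]
      ring
    rw [hfun]
    have ht : HasDerivAt (fun t : ℝ => (r.2 - a) + t) 1 0 := by simpa using (hasDerivAt_id (0 : ℝ)).const_add (r.2 - a)
    have hv : HasDerivAt (fun t : ℝ => h₂ r.1 - ((r.2 - a) + t)) (0 - 1) 0 := (hasDerivAt_const (0 : ℝ) (h₂ r.1)).sub ht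
    have h1 : HasDerivAt (fun t : ℝ => 1 - C * (((r.2 - a) + t) * (h₂ r.1 - ((r.2 - a) + t)) * w r.1)) _ 0 :=
      (hasDerivAt_const _ _).sub (((ht.mul hv).mul_const (w r.1)).const_mul C)
    rw [h1.deriv]
    simp only [add_zero]
    ring
  · rw [fderiv_apply_eq_deriv_line (hd r)]
    have hfun : (fun t : ℝ => gammaTwoHat h₂ w C a (r + t • ((1 : ℝ), (0 : ℝ)))) =
        fun t => 1 - C * ((r.2 - a) * (h₂ (r.1 + t) - (r.2 - a)) * w (r.1 + t)) := by
      funext t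
      simp only [gammaTwoHat, Prod.smul_mk, smul_eq_mul, mul_zero, mul_one, Prod.fst_add, Prod.snd_add, add_zero]
    rw [hfun]
    have hh : HasDerivAt (fun t : ℝ => h₂ (r.1 + t)) (deriv h₂ (r.1 + 0)) 0 :=
      HasDerivAt.comp_const_add r.1 0 (hh₂d (r.1 + 0)).hasDerivAt
    have hww : HasDerivAt (fun t : ℝ => w (r.1 + t)) (deriv w (r.1 + 0)) 0 :=
      HasDerivAt.comp_const_add r.1 0 (hwd (r.1 + 0)).hasDerivAt
    have h1 : HasDerivAt (fun t : ℝ => 1 - C * ((r.2 - a) * (h₂ (r.1 + t) - (r.2 - a)) * w (r.1 + t))) _ 0 :=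
      (hasDerivAt_const _ _).sub ((((hh.sub_const (r.2 - a)).const_mul (r.2 - a)).mul hww).const_mul C)
    rw [h1.deriv]
    simp only [add_zero]
    ring

/-- The second derivative of a differentiable CLM-valued map, along a line. [folklore] -/
theorem fderiv_clm_apply_eq_deriv_line {F : ℝ × ℝ → (ℝ × ℝ →L[ℝ] ℝ)} {p : ℝ × ℝ}
    (hF : DifferentiableAt ℝ F p) (v u : ℝ × ℝ) :
    fderiv ℝ F p v u = deriv (fun t : ℝ => F (p + t • v) u) 0 := by
  have hl : HasDerivAt (fun t : ℝ => p + t • v) v 0 := by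
    simpa using ((hasDerivAt_id (0 : ℝ)).smul_const v).const_add p
  have hp0 : p + (0 : ℝ) • v = p := by simp
  have hF' := hF.hasFDerivAt
  rw [← hp0] at hF'
  have h1 : HasDerivAt (fun t : ℝ => F (p + t • v)) (fderiv ℝ F p v) 0 := by
    have := hF'.comp_hasDerivAt (0 : ℝ) hl
    simpa only [zero_smul, add_zero, Function.comp_def] using this
  have h2 : HasDerivAt (fun t : ℝ => F (p + t • v) u) (fderiv ℝ F p v u) 0 :=
    ((ContinuousLinearMap.apply ℝ ℝ u).hasFDerivAt.comp_hasDerivAt (0 : ℝ) h1)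
  exact h2.deriv.symm

/-- **`∂₂₂Γ̂₂ = 2C w(p)`.** [folklore] -/
theorem fderiv_fderiv_gammaTwoHat (hh₂ : ContDiff ℝ ∞ h₂) (hw : ContDiff ℝ ∞ w) (C a : ℝ) (r : ℝ × ℝ) :
    fderiv ℝ (fderiv ℝ (gammaTwoHat h₂ w C a)) r (0, 1) (0, 1) = 2 * C * w r.1 := by
  have hc : ContDiff ℝ ∞ (gammaTwoHat h₂ w C a) := contDiff_gammaTwoHat hh₂ hw C a
  have hFd : DifferentiableAt ℝ (fderiv ℝ (gammaTwoHat h₂ w C a)) r :=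
    ((hc.fderiv_right (m := 1) (by norm_cast)).differentiable (by simp)) r
  rw [fderiv_clm_apply_eq_deriv_line hFd]
  have hfun : (fun t : ℝ => fderiv ℝ (gammaTwoHat h₂ w C a) (r + t • ((0 : ℝ), (1 : ℝ))) ((0 : ℝ), (1 : ℝ))) =
      fun t => -C * (w r.1 * (h₂ r.1 - 2 * ((r.2 - a) + t))) := by
    funext t
    rw [(gammaTwoHat_partials hh₂ hw C a _).1]
    simp only [Prod.smul_mk, smul_eq_mul, mul_zero, mul_one, Prod.fst_add, Prod.snd_add, add_zero]
    ring
  rw [hfun]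
  have h1 : HasDerivAt (fun t : ℝ => -C * (w r.1 * (h₂ r.1 - 2 * ((r.2 - a) + t)))) (-C * (w r.1 * (0 - 2 * 1))) 0 := by
    have ht : HasDerivAt (fun t : ℝ => (r.2 - a) + t) 1 0 := by simpa using (hasDerivAt_id (0 : ℝ)).const_add (r.2 - a)
    exact (((hasDerivAt_const _ _).sub (ht.const_mul 2)).const_mul (w r.1)).const_mul (-C)
  rw [h1.deriv]; ring

end Profile

/-! ### Critical points and index in the flow-rule region -/

section FlowRule

variable {X : Type u} [TopologicalSpace X] [T2Space X] [CompactSpace X] [ChartedSpace (𝔼 4) X]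
  [IsManifold (𝓡 4) ∞ X]
  {f : X → ℝ} {ξ : Π x : X, TangentSpace (𝓡 4) x} {a η : ℝ} {ι : Type} [Fintype ι]
  (H : HandleBoxes f ξ a η ι)
  {hξ : ContMDiff (𝓡 4) (𝓡 4).tangent ∞ fun x => (⟨x, ξ x⟩ : TangentBundle (𝓡 4) X)}
  {h : IsRegularLevel (𝓡 4) f a} {φ : RegularLevel h → ℝ} {h₂ TP χlo χhi w ρ R₀ : ℝ → ℝ}
  {Spl Sbot Smin Psw c₀ ε κ aR C : ℝ}

namespace HandleBoxes

/-- `ψ₂` agrees near a flow-rule point with `Γ̂₂(φ̄, f)` (plus the constant `0`). [folklore] -/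
theorem psiTwo_eventuallyEq_gammaTwoHat {z : X}
    (hraw : H.psiTwoRaw hξ h φ h₂ TP χlo χhi w ρ R₀ Spl Sbot Smin Psw c₀ ε κ aR =ᶠ[𝓝 z] fun z' =>
      (fun r : ℝ × ℝ => (r.2 - a) * (h₂ r.1 - (r.2 - a)) * w r.1) (flowLift hξ h φ z', f z')) :
    H.psiTwo hξ h φ h₂ TP χlo χhi w ρ R₀ Spl Sbot Smin Psw c₀ ε κ aR C =ᶠ[𝓝 z] fun z' =>
      (fun x => gammaTwoHat h₂ w C a (flowLift hξ h φ x, f x)) z' + 0 := by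
  filter_upwards [hraw] with z' hz'
  simp only [psiTwo, hz', gammaTwoHat, add_zero]

/-- **Critical points of `ψ₂` in the flow-rule region.**  At a hitting point `z` near which
`ψ₂ = Γ̂₂(φ̄, f)`, inside the sector (`s = f z - a ≠ 0`, `C ≠ 0`, `w(φ̄ z) ≠ 0`,
`h₂' w + (h₂ - s) w' ≠ 0` at `φ̄ z`): **`z` is critical for `ψ₂` iff `2s = h₂(φ̄ z)` and `π z` is
critical for `φ`.** [cite: GayKirby2016, §4, Lemma 14] [cite: MilnorHCobordism1965, Thm. 3.4] -/
theorem isMCriticalPt_psiTwo_flowRule_iff (hgl : IsGradientLike (𝓡 4) f ξ) (hfM : IsMorse (𝓡 4) f)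
    (hφs : ContMDiff (𝓡 3) 𝓘(ℝ, ℝ) ∞ φ) (hh₂ : ContDiff ℝ ∞ h₂) (hw : ContDiff ℝ ∞ w) {z : X}
    (hhit : Hits (flowθ hξ) f a z)
    (hraw : H.psiTwoRaw hξ h φ h₂ TP χlo χhi w ρ R₀ Spl Sbot Smin Psw c₀ ε κ aR =ᶠ[𝓝 z] fun z' =>
      (fun r : ℝ × ℝ => (r.2 - a) * (h₂ r.1 - (r.2 - a)) * w r.1) (flowLift hξ h φ z', f z'))
    (hC : C ≠ 0) (hs : f z - a ≠ 0) (hwz : w (flowLift hξ h φ z) ≠ 0)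
    (h1 : deriv h₂ (flowLift hξ h φ z) * w (flowLift hξ h φ z) +
      (h₂ (flowLift hξ h φ z) - (f z - a)) * deriv w (flowLift hξ h φ z) ≠ 0) :
    IsMCriticalPt (𝓡 4) (H.psiTwo hξ h φ h₂ TP χlo χhi w ρ R₀ Spl Sbot Smin Psw c₀ ε κ aR C) z ↔
      2 * (f z - a) = h₂ (flowLift hξ h φ z) ∧
        IsMCriticalPt (𝓡 3) φ ⟨levelProj hξ f a z, apply_levelProj hξ hhit⟩ := by
  have hev := H.psiTwo_eventuallyEq_gammaTwoHat (C := C) hraw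
  rw [isMCriticalPt_congr_of_eventuallyEq_add_const (I := 𝓡 4) hev,
    isMCriticalPt_comp₂_iff hgl hfM hφs hhit ((contDiff_gammaTwoHat hh₂ hw C a).contDiffAt.of_le (by norm_cast)),
    (gammaTwoHat_partials hh₂ hw C a _).1, (gammaTwoHat_partials hh₂ hw C a _).2]
  simp only
  constructor
  · rintro ⟨h0, h0'⟩
    have hq : h₂ (flowLift hξ h φ z) - 2 * (f z - a) = 0 := by
      rcases mul_eq_zero.1 h0 with h' | h'
      · exact absurd (neg_eq_zero.1 h') hC
      · rcases mul_eq_zero.1 h' with h'' | h''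
        · exact absurd h'' hwz
        · exact h''
    refine ⟨by linarith, ?_⟩
    rcases h0' with h' | h'
    · exfalso
      rcases mul_eq_zero.1 h' with h'' | h''
      · exact hC (neg_eq_zero.1 h'')
      · rcases mul_eq_zero.1 h'' with h3 | h3
        · exact hs h3
        · exact h1 h3
    · exact h'
  · rintro ⟨hq, hc⟩
    refine ⟨?_, Or.inr hc⟩
    rw [show h₂ (flowLift hξ h φ z) - 2 * (f z - a) = 0 by linarith]
    ring

/-- **Index and nondegeneracy of the flow-rule critical points of `ψ₂`.**  At such a critical
point, with `C > 0`, `s > 0`, `w(φ̄ z) > 0` and `h₂' w + (h₂ - s) w' < 0` at `φ̄ z` (so that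
`∂₂₂Γ̂₂ = 2Cw > 0` and `∂₁Γ̂₂ > 0`): the Hessian of `ψ₂` is nondegenerate and
**`index ψ₂ (z) = index φ (π z)`**. [cite: GayKirby2016, §4, Lemma 14] [cite: Milnor1963, §2–§3] -/
theorem morseData_psiTwo_flowRule (hgl : IsGradientLike (𝓡 4) f ξ) (hfM : IsMorse (𝓡 4) f)
    (hφM : IsMorse (𝓡 3) φ) (hh₂ : ContDiff ℝ ∞ h₂) (hw : ContDiff ℝ ∞ w) {z : X}
    (hhit : Hits (flowθ hξ) f a z)
    (hraw : H.psiTwoRaw hξ h φ h₂ TP χlo χhi w ρ R₀ Spl Sbot Smin Psw c₀ ε κ aR =ᶠ[𝓝 z] fun z' =>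
      (fun r : ℝ × ℝ => (r.2 - a) * (h₂ r.1 - (r.2 - a)) * w r.1) (flowLift hξ h φ z', f z'))
    (hC : 0 < C) (hs : 0 < f z - a) (hwz : 0 < w (flowLift hξ h φ z))
    (h1 : deriv h₂ (flowLift hξ h φ z) * w (flowLift hξ h φ z) +
      (h₂ (flowLift hξ h φ z) - (f z - a)) * deriv w (flowLift hξ h φ z) < 0)
    (hq : 2 * (f z - a) = h₂ (flowLift hξ h φ z))
    (hcrit : IsMCriticalPt (𝓡 3) φ ⟨levelProj hξ f a z, apply_levelProj hξ hhit⟩) :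
    (mhessian (𝓡 4) (H.psiTwo hξ h φ h₂ TP χlo χhi w ρ R₀ Spl Sbot Smin Psw c₀ ε κ aR C) z).Nondegenerate ∧
      morseIndex (𝓡 4) (H.psiTwo hξ h φ h₂ TP χlo χhi w ρ R₀ Spl Sbot Smin Psw c₀ ε κ aR C) z =
        morseIndex (𝓡 3) φ ⟨levelProj hξ f a z, apply_levelProj hξ hhit⟩ := by
  have hev := H.psiTwo_eventuallyEq_gammaTwoHat (C := C) hraw
  have hhess := mhessian_congr_of_eventuallyEq_add_const (I := 𝓡 4) hev
  -- `z = flow y₀ t₀`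
  set y₀ : RegularLevel h := ⟨levelProj hξ f a z, apply_levelProj hξ hhit⟩ with hy₀
  obtain ⟨t₀, ht₀⟩ := mem_range_flow_levelProj hξ (f := f) a z
  have ht₀' : flow hξ y₀.1 t₀ = z := ht₀
  have hφy : φ y₀ = flowLift hξ h φ z := (flowLift_of_hits φ hhit).symm
  -- the hypotheses of the flow rule at `(φ y₀, f (flow y₀ t₀))`
  have hΓ : ContDiffAt ℝ 2 (gammaTwoHat h₂ w C a) (φ y₀, f (flow hξ y₀.1 t₀)) :=
    (contDiff_gammaTwoHat hh₂ hw C a).contDiffAt.of_le (by norm_cast)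
  obtain ⟨hp01, hp10⟩ := gammaTwoHat_partials hh₂ hw C a (φ y₀, f (flow hξ y₀.1 t₀))
  have h22 := fderiv_fderiv_gammaTwoHat hh₂ hw C a (φ y₀, f (flow hξ y₀.1 t₀))
  simp only [ht₀', hφy] at hp01 hp10 h22 hΓ
  have h2 : fderiv ℝ (gammaTwoHat h₂ w C a) (flowLift hξ h φ z, f z) (0, 1) = 0 := by
    rw [hp01, show h₂ (flowLift hξ h φ z) - 2 * (f z - a) = 0 by linarith]; ring
  have h1pos : 0 < fderiv ℝ (gammaTwoHat h₂ w C a) (flowLift hξ h φ z, f z) (1, 0) := by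
    rw [hp10]
    have : (f z - a) * (deriv h₂ (flowLift hξ h φ z) * w (flowLift hξ h φ z) +
        (h₂ (flowLift hξ h φ z) - (f z - a)) * deriv w (flowLift hξ h φ z)) < 0 := mul_neg_of_pos_of_neg hs h1
    nlinarith
  have h22pos : 0 < fderiv ℝ (fderiv ℝ (gammaTwoHat h₂ w C a)) (flowLift hξ h φ z, f z) (0, 1) (0, 1) := by
    rw [h22]; positivity
  have key := nondegenerate_iff_and_morseIndex_comp₂_flow (Γ := gammaTwoHat h₂ w C a) hgl hfM hφM y₀ t₀ hcrit
    (by rw [ht₀', hφy]; exact hΓ) (by rw [ht₀', hφy]; exact h2) (by rw [ht₀', hφy]; exact h1pos.ne')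
  rw [ht₀', hφy] at key
  obtain ⟨hnd, hidx⟩ := key
  refine ⟨?_, ?_⟩
  · rw [hhess]; exact hnd.2 h22pos.ne'
  · unfold morseIndex
    rw [hhess]
    have := hidx h22pos.ne'
    unfold morseIndex at this
    rw [this, if_neg (not_lt.2 h22pos.le), if_pos h1pos, zero_add]

end HandleBoxes

end FlowRule

end Literature.Topology.FourManifolds

end
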